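import Mathlib.NumberTheory.Zsqrtd.GaussianInt
import Mathlib.Data.Set.Card
import Mathlib.Tactic.IntervalCases
import Mathlib.Tactic.Linarith
import Mathlib.Tactic.Ring
import Literature.Algebra.EuclideanDomain.MotzkinConstruction
import Literature.NumberTheory.QuadraticFields.GaussianDigitExpansions
import Literature.NumberTheory.QuadraticFields.GaussianTwoSquaresResidueSystem
import HarnessLib

/-!
# The minimal Euclidean function on the Gaussian integers: `A_{ℤ[i],n} = B_n` (Graves 2023, §§3, 5)

Topic `Literature/NumberTheory/QuadraticFields`, namespace `Literature.NumberTheory.QuadraticFields.GaussianDigits`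
(Gaussian integers = Mathlib's `ℤ√(-1)`).  THEOREMS ONLY (no `def`, no instance, no named fact); everything
PROVED.  Third of three files formalising Graves' paper; it combines `GaussianDigitExpansions.lean` (§2: the
digit sets `B_n = digitSet n`, widths `w_n = width n`, octagons `Oct_n = octagon n`, Theorem 2.5) and
`GaussianTwoSquaresResidueSystem.lean` (§4) with Motzkin's construction
(`Literature.Algebra.EuclideanDomain.MotzkinConstruction`: `motzkinSet k = P₀^{(k)}`, `motzkinNorm`).

## Source (read at the page)

H. Graves, *The minimal Euclidean function on the Gaussian integers*, Indag. Math. (N.S.) **34** (2023) 78–88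
[Graves2023] (materialised `paper:arxiv-1802.08281`, pp. 1–2, 6, 8–9), VERBATIM:
* Def. 1.2 («Motzkin's Construction»): «`A_{R,0} := 0 ∪ R^×`, `A_{R,j} := A_{R,j−1} ∪ {β : A_{R,j−1} ↠ R/β}`,
  and `A_R := ⋃_{j=0}^∞ A_{R,j}`», where «`A_{R,j} ↠ R/β` if, for every `[a] ∈ R/β`, there exists some
  `r ∈ A_{R,j}` such that `[a] = [r]`.»  Lemma 1.3 (Motzkin): «… `φ_R(a) := j` if `a ∈ A_{R,j} ∖ A_{R,j−1}`,
  then `φ_R(a) = min_{f ∈ F} f(a)` and `φ_R` is itself a Euclidean function.»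
* Lemma 3.1: «The sets `A_{ℤ[i],n}` are closed under complex conjugation.»  Corollary 3.2: «An element
  `a+bi ∈ A_{ℤ[i],n}` if and only if `{±a ± bi}, {±b ± ai} ⊂ A_{ℤ[i],n}`.»
* Lemma 3.3: «If `A_{ℤ[i],n} = B_n`, then `A_{ℤ[i],n+1} ⊂ B_{n+1}`.»  Lemma 3.4: «If `A_{ℤ[i],j} = B_j` for all
  `j ≤ n`, then `(1+i)B_n ⊂ A_{ℤ[i],n+1}`.»
* Lemma 5.2 / Theorem 5.3's proof: for `a+bi ∈ B_{n+1} ∖ B_n` with `(1+i) ∤ a+bi`, `B_n ↠ ℤ[i]/(a+bi)`, shown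
  by covering the triangle `𝒮 = {x+yi : 0 ≤ x, y; x+y < a}` with `U = ⋃_z (B_n + z(a+bi))`.
* Theorem 5.3: «For `n ≥ 0`, `A_{ℤ[i],n} = B_n`.»  With Lemma 1.3: `φ_{ℤ[i]}`, the minimal Euclidean function
  on `ℤ[i]`, takes the value `n` exactly on `B_n ∖ B_{n−1}` (§1: «the natural next step of Motzkin's work would
  be to show that `φ_{ℤ[i]}` is one less than the number of digits in the `(1+i)`-ary expansion»).

## Dictionary

Graves' `A_{R,n}` is the complement of Motzkin's `P₀^{(n+1)}`: `A_{R,0} = 0 ∪ R^× = (P₀′)ᶜ`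
(`motzkinSet_one`) and `β ∈ A_{R,n} ↔ β ∈ A_{R,n−1} ∨ (every class mod β meets A_{R,n−1}) ↔
β ∉ (P₀^{(n)})′ = P₀^{(n+1)}` (`mem_motzkinDerived`).  So Theorem 5.3 reads
**`motzkinSet (n+1) = (digitSet n)ᶜ`** (`motzkinSet_succ_eq_compl_digitSet`), and «`B_n ↠ ℤ[i]/β`» is
`∀ z, ∃ r ∈ digitSet n, β ∣ z − r`.

## The proof of Theorem 5.3, and where it deviates from the printed one

The induction is Graves' (Lemmas 3.3, 3.4 and, for `β ∈ B_{n+1} ∖ B_n` prime to `1+i`, the covering of the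
triangle `𝒮` of §4), with the base case `A_{ℤ[i],0} = B₀` and NO separate check of `n = 1` (the covering
argument below works for every `n ≥ 0`).  The covering itself (`exists_sub_mul_mem_digitSet`, the union of
Lemma 5.2 and the two cases of the printed proof of Theorem 5.3) is RE-DERIVED: the printed case analysis has
gaps (e.g. Lemma 5.2 asserts `c+di ∈ Oct_n + (a+bi)` for even `c+di ∈ 𝒮` with `c+d ≥ 3+a+b−w_{n+1}`, which
fails for `n = 6`, `a+bi = 22+9i`, `c+di = 20i`: `20i − (22+9i) = −22+11i` has `|x|+|y| = 33 > w₇ − 3 = 29`;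
that point is covered by `20i − i(22+9i) = 9 − 2i` instead).  Our leaves, for `p = x+yi ∈ 𝒮`,
`β = a+bi`, `a > b ≥ 0`, `a ≢ b (2)`, `β ∈ Oct_{n+1}`: `p = 0`; `p` prime to `2` inside the box
`|x|,|y| ≤ w_n−2` (then `p ∈ Oct_n ⊆`-wise `B_n`, Cor. 2.6); `p` prime to `2` with `y ≥ w_n − 1` (then `iβ − p`
or `(1+i)β − p ∈ B_n`); with `x ≥ w_n − 1` (then `β − p` or `(1−i)β − p ∈ B_n`); `p` even: `p − β` or `p − iβ`
is prime to `2` and in `Oct_n`, or else `p ∈ B_n` by Theorem 2.5 (the «`𝒮★`» part of the printed proof).  Each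
leaf is the printed kind of estimate («if `2^k ∥ (a−y, b+x)` then … `≤ w_{n+1} − 3·2^k`»), discharged by
linear arithmetic from the divisibility gains `2^k ∣ m > 0 ⇒ 2^k ≤ m`; the leaf structure was checked
exhaustively by machine for `n ≤ 9` before formalisation (recorded in the seat notes), and is of course
proved here for all `n`.  The reduction of an arbitrary `β` prime to `1+i` to `a > b ≥ 0` uses the units
and conjugation (Lemma 3.1 / Corollary 3.2, here in the form `forall_exists_dvd_sub_of_*`).

## Main statements

* `ringEquiv_mem_motzkinSet_iff` (Motzkin's sets are invariant under ring automorphisms; Lemma 3.1 =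
  `star_mem_motzkinSet_iff`, Cor. 3.2), `exists_add_mul_not_mem_motzkinSet` (the surjection `A_{n−1} ↠ R/β`
  for `β ∈ A_n ∖ 0`), `mem_digitSet_succ_of_not_mem_motzkinSet` (Lemma 3.3),
  `oneAddI_mul_not_mem_motzkinSet` (Lemma 3.4), `exists_sub_mul_mem_digitSet` (the covering of `𝒮`),
  `forall_exists_dvd_sub_of_mem_octagon` (`B_n ↠ ℤ[i]/β` for `β ∈ Oct_{n+1}` prime to `1+i`).
* **`not_mem_motzkinSet_succ_iff`** / **`motzkinSet_succ_eq_compl_digitSet`** (THEOREM 5.3),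
  `exists_mem_digitSet` and `forall_exists_not_mem_motzkinSet` (`ℤ[i] = ⋃ B_n`, Motzkin's criterion holds),
  **`motzkinNorm_le_iff_mem_digitSet`** (the minimal Euclidean function: `φ_{ℤ[i]}(z) ≤ n ↔ z ∈ B_n` for
  `z ≠ 0`, i.e. `φ_{ℤ[i]}(z) + 1` is the number of digits of a shortest `(1+i)`-ary expansion of `z`).

## Mathlib / tree search

Mathlib: `GaussianInt` (`ℤ√(-1)`, Euclidean for the norm — Graves §3: «It is well-known that `ℤ[i]` is
norm-Euclidean»; not needed here since `ℤ[i] = ⋃ B_n` is proved directly), `IsUnit.mul_left_dvd`,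
`Zsqrtd.norm_eq_one_iff'`, `starRingAut`.  Tree: `motzkinSet`, `motzkinSet_one`, `mem_motzkinDerived`,
`motzkinRank_le_iff`, `motzkinNorm`, `mem_motzkinSet_motzkinNorm` (`MotzkinConstruction.lean`); the
universal side divisors of `ℤ[i]` = `B₁ ∖ B₀` (`ImaginaryQuadraticUniversalSideDivisors.lean`, consistent with
`n = 1` here); §2 and §4 of the paper in the two sibling files.
-/

namespace Literature.NumberTheory.QuadraticFields.GaussianDigits

open _root_.Zsqrtd Literature.Algebra.EuclideanDomain

/-! ## §1 Motzkin's sets under ring automorphisms (Lemma 3.1, Corollary 3.2) -/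

section General

variable {R : Type*} [CommRing R]

/-- Motzkin's sets `P₀^{(k)}` are invariant under ring automorphisms (the construction is intrinsic).
[cite: Graves2023, Lemma 3.1 (p. 6)] -/
theorem ringEquiv_mem_motzkinSet_iff (e : R ≃+* R) (k : ℕ) (b : R) :
    e b ∈ (motzkinSet k : Set R) ↔ b ∈ motzkinSet k := by
  induction k generalizing b e with
  | zero => simp
  | succ k ih =>
    rw [motzkinSet_succ, mem_motzkinDerived, mem_motzkinDerived, ih]
    refine and_congr_right fun _ ↦ ⟨?_, ?_⟩
    · rintro ⟨a, ha⟩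
      refine ⟨e.symm a, fun q ↦ ?_⟩
      have h := ha (e q)
      rw [show a + e b * e q = e (e.symm a + b * q) by simp] at h
      exact (ih (e := e) (b := e.symm a + b * q)).mp h
    · rintro ⟨a, ha⟩
      refine ⟨e a, fun q ↦ ?_⟩
      rw [show e a + e b * q = e (a + b * e.symm q) by simp]
      exact (ih (e := e) (b := a + b * e.symm q)).mpr (ha (e.symm q))

/-- **Lemma 3.1** (for any commutative star ring, e.g. `ℤ[i]` with complex conjugation): `P₀^{(k)}`, hence
its complement `A_{R,k−1}`, is closed under conjugation. [cite: Graves2023, Lemma 3.1 (p. 6)] -/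
theorem star_mem_motzkinSet_iff [StarRing R] (k : ℕ) (b : R) :
    star b ∈ (motzkinSet k : Set R) ↔ b ∈ motzkinSet k :=
  ringEquiv_mem_motzkinSet_iff (starRingAut : RingAut R) k b

/-- **Corollary 3.2** (unit multiples): for a unit `u`, `ub ∈ P₀^{(k)} ↔ b ∈ P₀^{(k)}` (in a domain).
[cite: Graves2023, Cor. 3.2 (p. 6)] -/
theorem unit_mul_mem_motzkinSet_iff [IsDomain R] {u : R} (hu : IsUnit u) (k : ℕ) (b : R) :
    u * b ∈ (motzkinSet k : Set R) ↔ b ∈ motzkinSet k := by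
  obtain ⟨v, hv⟩ := hu.exists_left_inv
  refine ⟨fun h ↦ ?_, fun h ↦ by rw [mul_comm]; exact mul_mem_motzkinSet h hu.ne_zero⟩
  have h' := mul_mem_motzkinSet h (left_ne_zero_of_mul_eq_one hv)
  rwa [mul_comm u b, mul_assoc, mul_comm u v, hv, mul_one] at h'

/-- The surjection in Graves' definition: if `β ≠ 0` lies in `A_{R,m} = (P₀^{(m+1)})ᶜ` then every residue
class modulo `β` meets `A_{R,m−1} = (P₀^{(m)})ᶜ` (for `β ∈ A_{R,m} ∖ A_{R,m−1}` by definition, for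
`β ∈ A_{R,m−1}` because the `A`'s increase). [cite: Graves2023, Def. 1.2 (p. 1)] -/
theorem exists_add_mul_not_mem_motzkinSet {m : ℕ} {β : R} (hβ0 : β ≠ 0) (hβ : β ∉ (motzkinSet (m + 1) : Set R))
    (a : R) : ∃ q : R, a + β * q ∉ (motzkinSet m : Set R) := by
  induction m with
  | zero =>
    rw [motzkinSet_one] at hβ
    simp only [Set.mem_setOf_eq, not_and, not_not] at hβ
    obtain ⟨v, hv⟩ := (hβ hβ0).exists_left_inv
    exact ⟨-(v * a), by simp only [motzkinSet_zero, Set.mem_setOf_eq, not_not]; linear_combination (-a) * hv⟩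
  | succ m ih =>
    rw [motzkinSet_succ, mem_motzkinDerived] at hβ
    simp only [not_and, not_exists, not_forall] at hβ
    by_cases h : β ∈ (motzkinSet (m + 1) : Set R)
    · exact hβ h a
    · obtain ⟨q, hq⟩ := ih h
      exact ⟨q, fun h' ↦ hq (motzkinSet_succ_subset m h')⟩

/-- Conversely, if `β ∉ P₀^{(m+1)}` fails… more precisely: if every class modulo `β` meets `(P₀^{(m)})ᶜ`
then `β ∉ P₀^{(m+1)}` (`β ∈ A_{R,m}`). [cite: Graves2023, Def. 1.2 (p. 1)] -/
theorem not_mem_motzkinSet_succ_of_forall {m : ℕ} {β : R} (h : ∀ a : R, ∃ q : R, a + β * q ∉ (motzkinSet m : Set R)) :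
    β ∉ (motzkinSet (m + 1) : Set R) := by
  rw [motzkinSet_succ, mem_motzkinDerived]
  rintro ⟨-, a, ha⟩
  obtain ⟨q, hq⟩ := h a
  exact hq (ha q)

end General

/-! ## §2 Lemmas 3.3 and 3.4 -/

/-- Residues modulo `1+i`: every Gaussian integer is `(1+i)q + r` with `r ∈ {0, 1}`.
[cite: Graves2023, Lemma 3.4 (proof, p. 6)] -/
theorem exists_eq_oneAddI_mul_add (x : ℤ√(-1)) :
    ∃ q r : ℤ√(-1), x = ⟨1, 1⟩ * q + r ∧ (r = 0 ∨ r = 1) := by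
  rcases Int.emod_two_eq_zero_or_one (x.re + x.im) with h | h
  · obtain ⟨q, hq⟩ := oneAddI_dvd_iff.mpr (Int.dvd_of_emod_eq_zero h)
    exact ⟨q, 0, by rw [hq, add_zero], Or.inl rfl⟩
  · have h1 : (⟨1, 1⟩ : ℤ√(-1)) ∣ x - 1 := oneAddI_dvd_iff.mpr (by simp; omega)
    obtain ⟨q, hq⟩ := h1
    exact ⟨q, 1, by rw [← hq, sub_add_cancel], Or.inr rfl⟩

/-- **Lemma 3.3**: «If `A_{ℤ[i],n} = B_n`, then `A_{ℤ[i],n+1} ⊂ B_{n+1}`» (with `A_{ℤ[i],m} = (P₀^{(m+1)})ᶜ`).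
Proof as printed: `(1+i)^{n+1} = qβ + r` with `r ∈ B_n`, so `qβ = (1+i)^{n+1} − r ∈ B_{n+1} ∖ 0` and
Corollary 2.7 applies. [cite: Graves2023, Lemma 3.3 (p. 6)] -/
theorem mem_digitSet_succ_of_not_mem_motzkinSet {n : ℕ}
    (ih : ∀ z : ℤ√(-1), z ∉ (motzkinSet (n + 1) : Set (ℤ√(-1))) ↔ z ∈ digitSet n) {β : ℤ√(-1)}
    (hβ : β ∉ (motzkinSet (n + 2) : Set (ℤ√(-1)))) : β ∈ digitSet (n + 1) := by
  by_cases hβn : β ∈ (motzkinSet (n + 1) : Set (ℤ√(-1)))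
  · -- every class modulo `β` meets `B_n`: take the class of `(1+i)^{n+1}`
    obtain ⟨q, hq⟩ := exists_add_mul_not_mem_motzkinSet (ne_zero_of_mem_motzkinSet hβn) hβ (⟨1, 1⟩ ^ (n + 1))
    rw [ih] at hq
    -- `β(−q) = (1+i)^{n+1} − r ∈ B_{n+1}`
    have hmem : -(⟨1, 1⟩ ^ (n + 1) + β * q) + 1 * ⟨1, 1⟩ ^ (n + 1) ∈ digitSet (n + 1) :=
      add_mul_pow_mem_digitSet one_mem_digits (neg_mem_digitSet hq)
    rw [show -(⟨1, 1⟩ ^ (n + 1) + β * q) + 1 * ⟨1, 1⟩ ^ (n + 1) = β * -q by ring] at hmem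
    refine mem_digitSet_of_mul_mem hmem fun h0 ↦ pow_not_mem_digitSet n ?_
    rwa [show β * q = 0 by simpa [mul_neg, neg_eq_zero] using h0, add_zero] at hq
  · exact digitSet_subset_succ n ((ih β).mp hβn)

/-- **Lemma 3.4**: «If `A_{ℤ[i],j} = B_j` for all `j ≤ n`, then `(1+i)B_n ⊂ A_{ℤ[i],n+1}`.»  Proof as printed:
`x = (1+i)q + r` with `r ∈ {0,1}`, `q = q'a + r'` with `r' ∈ A_{n−1}`, so `x = q'(1+i)a + ((1+i)r' + r)` with
`(1+i)r' + r ∈ B_n`. [cite: Graves2023, Lemma 3.4 (p. 6)] -/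
theorem oneAddI_mul_not_mem_motzkinSet {n : ℕ}
    (ih : ∀ m ≤ n, ∀ z : ℤ√(-1), z ∉ (motzkinSet (m + 1) : Set (ℤ√(-1))) ↔ z ∈ digitSet m) {z : ℤ√(-1)}
    (hz : z ∈ digitSet n) : ⟨1, 1⟩ * z ∉ (motzkinSet (n + 2) : Set (ℤ√(-1))) := by
  by_cases hz0 : z = 0
  · rw [hz0, mul_zero]; exact fun h ↦ ne_zero_of_mem_motzkinSet h rfl
  have hzA : z ∉ (motzkinSet (n + 1) : Set (ℤ√(-1))) := (ih n le_rfl z).mpr hz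
  refine not_mem_motzkinSet_succ_of_forall fun x ↦ ?_
  obtain ⟨q₀, r, hx, hr⟩ := exists_eq_oneAddI_mul_add x
  obtain ⟨q', hq'⟩ := exists_add_mul_not_mem_motzkinSet hz0 hzA q₀
  refine ⟨q', ?_⟩
  rw [hx, show ⟨1, 1⟩ * q₀ + r + ⟨1, 1⟩ * z * q' = r + ⟨1, 1⟩ * (q₀ + z * q') by ring, ih n le_rfl]
  have hr' : r ∈ digits := by rcases hr with rfl | rfl; exacts [zero_mem_digits, one_mem_digits]
  cases n with
  | zero =>
    have h0 : q₀ + z * q' = 0 := by simpa using hq'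
    rw [h0, mul_zero, add_zero]
    exact hr'
  | succ m =>
    exact add_mul_mem_digitSet_succ hr' ((ih m (Nat.le_succ m) _).mp hq')

/-! ## §3 Covering the triangle `𝒮` (Lemma 5.2 and the proof of Theorem 5.3)

Throughout: `β = a + bi` with `a > b ≥ 0`, `a ≢ b (mod 2)`, `β ∈ Oct_{n+1}` (`a ≤ w_{n+1} − 2`,
`a + b ≤ w_{n+2} − 3`); `K = 2^{⌊n/2⌋}`, so `(w_n, w_{n+1}) = (3K, 4K)` or `(4K, 6K)` and `w_{n+2} = 2w_n`;
`p = x + yi` with `x, y ≥ 0`, `x + y < a`.  Goal of each leaf: `p − qβ ∈ B_n` for some `q ∈ ℤ[i]`. -/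

section Leaves

/-- `2^k < 2·2^m ⇒ 2^k ∣ 2^m`. [folklore] -/
private theorem two_pow_dvd_of_lt {k m : ℕ} (h : (2 : ℤ) ^ k < 2 * 2 ^ m) : (2 : ℤ) ^ k ∣ 2 ^ m := by
  refine pow_dvd_pow 2 ?_
  by_contra hlt
  have : (2 : ℤ) ^ (m + 1) ≤ 2 ^ k := pow_le_pow_right₀ (by norm_num) (by omega)
  rw [pow_succ] at this
  linarith

/-- The divisibility gain: `P ∣ Q`, `Q > 0` ⇒ `P ≤ Q`. [folklore] -/
private theorem gain {P Q : ℤ} (hd : P ∣ Q) (hQ : 0 < Q) : P ≤ Q := Int.le_of_dvd hQ hd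

/-- The divisibility gain as a disjunction (for `omega`): `Q ≤ 0 ∨ P ≤ Q`. [folklore] -/
private theorem gain' {P Q : ℤ} (hd : P ∣ Q) : Q ≤ 0 ∨ P ≤ Q := by
  by_cases h : 0 < Q
  · exact Or.inr (gain hd h)
  · exact Or.inl (not_lt.mp h)

/-- From `2^k ∣ K` and the shape of the widths: `2^k` divides `w_n` and `w_{n+1}`. [folklore] -/
private theorem dvd_widths {n k : ℕ} {K : ℤ} (hPK : (2 : ℤ) ^ k ∣ K)
    (hW : (width n = 3 * K ∧ width (n + 1) = 4 * K) ∨ (width n = 4 * K ∧ width (n + 1) = 6 * K)) :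
    (2 : ℤ) ^ k ∣ width n ∧ (2 : ℤ) ^ k ∣ width (n + 1) := by
  rcases hW with ⟨h0, h1⟩ | ⟨h0, h1⟩ <;> rw [h0, h1] <;> exact ⟨hPK.mul_left _, hPK.mul_left _⟩

/-- `p − (m + ki)β` in coordinates. [folklore] -/
private theorem sub_mul_eq_mk {x y a b m k u v : ℤ} (hu : u = x - (m * a - k * b))
    (hv : v = y - (m * b + k * a)) : (⟨x, y⟩ : ℤ√(-1)) - ⟨m, k⟩ * ⟨a, b⟩ = ⟨u, v⟩ := by
  subst hu hv
  exact Zsqrtd.ext (by simp only [re_sub, re_mul]; ring) (by simp only [im_sub, im_mul])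

/-- `p − (m + ki)β = −c` in coordinates. [folklore] -/
private theorem sub_mul_eq_neg_mk {x y a b m k u v : ℤ} (hu : u = m * a - k * b - x)
    (hv : v = m * b + k * a - y) : (⟨x, y⟩ : ℤ√(-1)) - ⟨m, k⟩ * ⟨a, b⟩ = -⟨u, v⟩ := by
  subst hu hv
  exact Zsqrtd.ext (by simp only [re_sub, re_mul, re_neg]; ring) (by simp only [im_sub, im_mul, im_neg]; ring)

variable {n : ℕ} {K a b x y : ℤ}

/-- Leaf: `p = x+yi` prime to `2` in the box `x, y ≤ w_n − 2` — then `p ∈ Oct_n`, so `p ∈ B_n` (Cor. 2.6).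
[cite: Graves2023, Thm. 5.3 (proof, p. 8)] -/
private theorem leaf_box (ha1 : a ≤ width (n + 1) - 2) (hx : 0 ≤ x) (hy : 0 ≤ y) (hxy : x + y < a)
    (hpar : x % 2 = 1 ∨ y % 2 = 1) (hxW : x ≤ width n - 2) (hyW : y ≤ width n - 2) :
    ∃ q : ℤ√(-1), (⟨x, y⟩ : ℤ√(-1)) - q * ⟨a, b⟩ ∈ digitSet n :=
  ⟨0, by
    rw [zero_mul, sub_zero]
    exact mem_digitSet_of_not_two_dvd (fun ⟨h1, h2⟩ ↦ by dsimp only at h1 h2; omega)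
      (mem_octagon_iff.mpr ⟨by dsimp only; omega, by dsimp only; omega, by dsimp only; omega⟩)⟩

/-- Leaf: `p` prime to `2` with `y ≥ w_n − 1` — then `iβ − p = −(b+x) + (a−y)i ∈ B_n` (if, for
`2^k ∥ (b+x, a−y)`, `b + x ≤ w_n − 2^{k+1}`), or else `(1+i)β − p ∈ Oct_n` is prime to `2`.
[cite: Graves2023, Thm. 5.3 (proof, pp. 8–9)] -/
private theorem leaf_top (hK : K = 2 ^ (n / 2))
    (hW : (width n = 3 * K ∧ width (n + 1) = 4 * K) ∨ (width n = 4 * K ∧ width (n + 1) = 6 * K))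
    (hW2 : width (n + 1 + 1) = 2 * width n) (hab : b < a) (hb : 0 ≤ b) (hodd : (a + b) % 2 = 1)
    (ha1 : a ≤ width (n + 1) - 2) (hab2 : a + b ≤ width (n + 1 + 1) - 3)
    (hx : 0 ≤ x) (hy : 0 ≤ y) (hxy : x + y < a) (hpar : x % 2 = 1 ∨ y % 2 = 1) (hyW : width n - 1 ≤ y) :
    ∃ q : ℤ√(-1), (⟨x, y⟩ : ℤ√(-1)) - q * ⟨a, b⟩ ∈ digitSet n := by
  have hKpos : 0 < K := by rw [hK]; positivity
  have hc0 : (⟨-(b + x), a - y⟩ : ℤ√(-1)) ≠ 0 := fun h ↦ by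
    have := congrArg Zsqrtd.im h; simp at this; omega
  obtain ⟨k, ⟨hk1, hk2⟩, hk3⟩ := exists_exact_two_pow (x := -(b + x)) (y := a - y) (by omega)
  have hPpos : (0 : ℤ) < 2 ^ k := pow_pos two_pos k
  have hk1' : (2 : ℤ) ^ k ∣ b + x := dvd_neg.mp hk1
  have hPv : (2 : ℤ) ^ k ≤ a - y := gain hk2 (by omega)
  have hPK : (2 : ℤ) ^ k ∣ K := by
    have h : (2 : ℤ) ^ k < 2 * K := by omega
    rw [hK] at h ⊢; exact two_pow_dvd_of_lt h
  have hPleK : (2 : ℤ) ^ k ≤ K := gain hPK hKpos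
  obtain ⟨hPW0, hPW1⟩ := dvd_widths hPK hW
  have g1 : (2 : ℤ) ^ k ≤ width (n + 1) - width n - (a - y) :=
    gain (dvd_sub (dvd_sub hPW1 hPW0) hk2) (by omega)
  by_cases hu : b + x ≤ width n - 2 * 2 ^ k
  · -- `iβ − p ∈ B_n` by Theorem 2.5
    have hc : (⟨-(b + x), a - y⟩ : ℤ√(-1)) ∈ digitSet n := by
      refine (mem_digitSet_iff_of_exact hc0 ⟨hk1, hk2⟩ hk3).mpr ⟨?_, ?_, ?_⟩ <;> simp only [pow_succ] <;>
        omega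
    refine ⟨⟨0, 1⟩, ?_⟩
    rw [sub_mul_eq_neg_mk (u := -(b + x)) (v := a - y) (by ring) (by ring)]
    exact neg_mem_digitSet hc
  · -- `b + x ≥ w_n − 2^k`, `k ≥ 1`, `p` primitive; use `(1+i)β − p`
    have g2 : (2 : ℤ) ^ k ≤ b + x - (width n - 2 * 2 ^ k) :=
      gain (dvd_sub hk1' (dvd_sub hPW0 (dvd_mul_left _ _))) (by omega)
    cases k with
    | zero => simp only [pow_zero] at g2; omega
    | succ k =>
      have h2 : (2 : ℤ) ∣ 2 ^ (k + 1) := dvd_pow_self 2 (Nat.succ_ne_zero k)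
      have h2u : 2 ∣ b + x := h2.trans hk1'
      have h2v : 2 ∣ a - y := h2.trans hk2
      have hc : (⟨a - b - x, a + b - y⟩ : ℤ√(-1)) ∈ digitSet n :=
        mem_digitSet_of_not_two_dvd (fun ⟨h1, h2⟩ ↦ by dsimp only at h1 h2; omega)
          (mem_octagon_iff.mpr ⟨by dsimp only; omega, by dsimp only; omega, by dsimp only; omega⟩)
      refine ⟨⟨1, 1⟩, ?_⟩
      rw [sub_mul_eq_neg_mk (u := a - b - x) (v := a + b - y) (by ring) (by ring)]
      exact neg_mem_digitSet hc

/-- Leaf: `p` prime to `2` with `x ≥ w_n − 1` — then `β − p = (a−x) + (b−y)i ∈ B_n`, or else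
`(1−i)β − p ∈ Oct_n` is prime to `2`. [cite: Graves2023, Thm. 5.3 (proof, pp. 8–9)] -/
private theorem leaf_right (hK : K = 2 ^ (n / 2))
    (hW : (width n = 3 * K ∧ width (n + 1) = 4 * K) ∨ (width n = 4 * K ∧ width (n + 1) = 6 * K))
    (hW2 : width (n + 1 + 1) = 2 * width n) (hb : 0 ≤ b) (hodd : (a + b) % 2 = 1)
    (ha1 : a ≤ width (n + 1) - 2) (hab2 : a + b ≤ width (n + 1 + 1) - 3)
    (hx : 0 ≤ x) (hy : 0 ≤ y) (hxy : x + y < a) (hpar : x % 2 = 1 ∨ y % 2 = 1) (hxW : width n - 1 ≤ x) :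
    ∃ q : ℤ√(-1), (⟨x, y⟩ : ℤ√(-1)) - q * ⟨a, b⟩ ∈ digitSet n := by
  have hKpos : 0 < K := by rw [hK]; positivity
  have hc0 : (⟨a - x, b - y⟩ : ℤ√(-1)) ≠ 0 := fun h ↦ by
    have := congrArg Zsqrtd.re h; simp at this; omega
  obtain ⟨k, ⟨hk1, hk2⟩, hk3⟩ := exists_exact_two_pow (x := a - x) (y := b - y) (by omega)
  have hPpos : (0 : ℤ) < 2 ^ k := pow_pos two_pos k
  have hPv : (2 : ℤ) ^ k ≤ a - x := gain hk1 (by omega)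
  have hPK : (2 : ℤ) ^ k ∣ K := by
    have h : (2 : ℤ) ^ k < 2 * K := by omega
    rw [hK] at h ⊢; exact two_pow_dvd_of_lt h
  have hPleK : (2 : ℤ) ^ k ≤ K := gain hPK hKpos
  obtain ⟨hPW0, hPW1⟩ := dvd_widths hPK hW
  have g1 : (2 : ℤ) ^ k ≤ width (n + 1) - width n - (a - x) :=
    gain (dvd_sub (dvd_sub hPW1 hPW0) hk1) (by omega)
  -- the representative `β − p` works in the first two cases
  have hβp : (⟨a - x, b - y⟩ : ℤ√(-1)) ∈ digitSet n →
      ∃ q : ℤ√(-1), (⟨x, y⟩ : ℤ√(-1)) - q * ⟨a, b⟩ ∈ digitSet n := fun hc ↦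
    ⟨⟨1, 0⟩, by
      rw [sub_mul_eq_neg_mk (u := a - x) (v := b - y) (by ring) (by ring)]
      exact neg_mem_digitSet hc⟩
  by_cases ht0 : b - y ≤ 0
  · have g3 : (2 : ℤ) ^ k ≤ width (n + 1) - width n + (b - y) :=
      gain (dvd_add (dvd_sub hPW1 hPW0) hk2) (by omega)
    refine hβp ((mem_digitSet_iff_of_exact hc0 ⟨hk1, hk2⟩ hk3).mpr ⟨?_, ?_, ?_⟩) <;>
      simp only [pow_succ] <;> omega
  by_cases ht : b - y ≤ width n - 2 * 2 ^ k
  · refine hβp ((mem_digitSet_iff_of_exact hc0 ⟨hk1, hk2⟩ hk3).mpr ⟨?_, ?_, ?_⟩) <;>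
      simp only [pow_succ] <;> omega
  · -- `b − y ≥ w_n − 2^k`, `k ≥ 1`; use `(1−i)β − p = (a+b−x) + (b−a−y)i`
    have g4 : (2 : ℤ) ^ k ≤ b - y - (width n - 2 * 2 ^ k) :=
      gain (dvd_sub hk2 (dvd_sub hPW0 (dvd_mul_left _ _))) (by omega)
    cases k with
    | zero => simp only [pow_zero] at g4; omega
    | succ k =>
      have h2 : (2 : ℤ) ∣ 2 ^ (k + 1) := dvd_pow_self 2 (Nat.succ_ne_zero k)
      have h2u : 2 ∣ a - x := h2.trans hk1
      have h2v : 2 ∣ b - y := h2.trans hk2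
      have hc : (⟨a + b - x, b - a - y⟩ : ℤ√(-1)) ∈ digitSet n :=
        mem_digitSet_of_not_two_dvd (fun ⟨h1, h2⟩ ↦ by dsimp only at h1 h2; omega)
          (mem_octagon_iff.mpr ⟨by dsimp only; omega, by dsimp only; omega, by dsimp only; omega⟩)
      refine ⟨⟨1, -1⟩, ?_⟩
      rw [sub_mul_eq_neg_mk (u := a + b - x) (v := b - a - y) (by ring) (by ring)]
      exact neg_mem_digitSet hc

/-- Leaf: `p ≠ 0` even (`2 ∣ x`, `2 ∣ y`) — then `p − β` or `p − iβ` is prime to `2` and in `Oct_n`, or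
else (the «`𝒮★`» part) `p ∈ B_n` by Theorem 2.5. [cite: Graves2023, Thm. 5.3 (proof, pp. 8–9)] -/
private theorem leaf_even (hK : K = 2 ^ (n / 2))
    (hW : (width n = 3 * K ∧ width (n + 1) = 4 * K) ∨ (width n = 4 * K ∧ width (n + 1) = 6 * K))
    (hW2 : width (n + 1 + 1) = 2 * width n) (hab : b < a) (hb : 0 ≤ b) (hodd : (a + b) % 2 = 1)
    (ha1 : a ≤ width (n + 1) - 2) (hab2 : a + b ≤ width (n + 1 + 1) - 3)
    (hx : 0 ≤ x) (hy : 0 ≤ y) (hxy : x + y < a) (hev : x % 2 = 0 ∧ y % 2 = 0) (hp0 : ¬(x = 0 ∧ y = 0)) :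
    ∃ q : ℤ√(-1), (⟨x, y⟩ : ℤ√(-1)) - q * ⟨a, b⟩ ∈ digitSet n := by
  have hKpos : 0 < K := by rw [hK]; positivity
  by_cases hC1 : a - x ≤ width n - 2 ∧ ((y - b).natAbs : ℤ) ≤ width n - 2 ∧
      a - x + (y - b).natAbs ≤ width (n + 1) - 3
  · -- `p − β ∈ Oct_n`, prime to `2`
    refine ⟨⟨1, 0⟩, ?_⟩
    rw [sub_mul_eq_mk (u := x - a) (v := y - b) (by ring) (by ring)]
    exact mem_digitSet_of_not_two_dvd (fun ⟨h1, h2⟩ ↦ by dsimp only at h1 h2; omega)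
      (mem_octagon_iff.mpr ⟨by dsimp only; omega, by dsimp only; omega, by dsimp only; omega⟩)
  by_cases hC2 : x + b ≤ width n - 2 ∧ a - y ≤ width n - 2 ∧ x + b + (a - y) ≤ width (n + 1) - 3
  · -- `p − iβ ∈ Oct_n`, prime to `2`
    refine ⟨⟨0, 1⟩, ?_⟩
    rw [sub_mul_eq_mk (u := x + b) (v := y - a) (by ring) (by ring)]
    exact mem_digitSet_of_not_two_dvd (fun ⟨h1, h2⟩ ↦ by dsimp only at h1 h2; omega)
      (mem_octagon_iff.mpr ⟨by dsimp only; omega, by dsimp only; omega, by dsimp only; omega⟩)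
  -- the remaining region: `p` itself lies in `B_n`
  simp only [not_and_or, not_le] at hC1 hC2
  have hz : (⟨x, y⟩ : ℤ√(-1)) ≠ 0 := fun h ↦ hp0 ⟨congrArg Zsqrtd.re h, congrArg Zsqrtd.im h⟩
  obtain ⟨k, ⟨hk1, hk2⟩, hk3⟩ := exists_exact_two_pow (x := x) (y := y) hp0
  have hPpos : (0 : ℤ) < 2 ^ k := pow_pos two_pos k
  have hPx : x ≤ 0 ∨ (2 : ℤ) ^ k ≤ x := gain' hk1
  have hPy : y ≤ 0 ∨ (2 : ℤ) ^ k ≤ y := gain' hk2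
  have hPlt : (2 : ℤ) ^ k < 2 * K := by omega
  have hPK : (2 : ℤ) ^ k ∣ K := by rw [hK] at hPlt ⊢; exact two_pow_dvd_of_lt hPlt
  have hPleK : (2 : ℤ) ^ k ≤ K := gain hPK hKpos
  obtain ⟨hPW0, hPW1⟩ := dvd_widths hPK hW
  have g1 : width (n + 1) - width n - x ≤ 0 ∨ (2 : ℤ) ^ k ≤ width (n + 1) - width n - x :=
    gain' (dvd_sub (dvd_sub hPW1 hPW0) hk1)
  have g2 : width (n + 1) - width n - y ≤ 0 ∨ (2 : ℤ) ^ k ≤ width (n + 1) - width n - y :=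
    gain' (dvd_sub (dvd_sub hPW1 hPW0) hk2)
  have g3 : 2 * width n - width (n + 1) - (y - x) ≤ 0 ∨
      (2 : ℤ) ^ k ≤ 2 * width n - width (n + 1) - (y - x) :=
    gain' (dvd_sub (dvd_sub (hPW0.mul_left 2) hPW1) (dvd_sub hk2 hk1))
  have g4 : 2 * width n - width (n + 1) - (x + y) ≤ 0 ∨
      (2 : ℤ) ^ k ≤ 2 * width n - width (n + 1) - (x + y) :=
    gain' (dvd_sub (dvd_sub (hPW0.mul_left 2) hPW1) (dvd_add hk1 hk2))
  refine ⟨0, ?_⟩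
  rw [zero_mul, sub_zero]
  refine (mem_digitSet_iff_of_exact hz ⟨hk1, hk2⟩ hk3).mpr ?_
  simp only [pow_succ]
  rcases hC1 with h1 | h1 | h1 <;> rcases hC2 with h2 | h2 | h2 <;> omega

end Leaves

/-- **The covering of the triangle** (Lemma 5.2 together with both cases of the printed proof of
Theorem 5.3, re-derived — see the module docstring): for `β = a+bi ∈ Oct_{n+1}` with `a > b ≥ 0`,
`a ≢ b (mod 2)`, every `p = x+yi` with `x, y ≥ 0`, `x + y < a` is congruent modulo `β` to an element of
`B_n`. [cite: Graves2023, Thm. 5.3 (proof, pp. 8–9)] -/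
theorem exists_sub_mul_mem_digitSet {n : ℕ} {a b : ℤ} (hab : b < a) (hb : 0 ≤ b) (hodd : (a + b) % 2 = 1)
    (hβ : (⟨a, b⟩ : ℤ√(-1)) ∈ octagon (n + 1)) {x y : ℤ} (hx : 0 ≤ x) (hy : 0 ≤ y) (hxy : x + y < a) :
    ∃ q : ℤ√(-1), (⟨x, y⟩ : ℤ√(-1)) - q * ⟨a, b⟩ ∈ digitSet n := by
  obtain ⟨K, hK, hW⟩ := width_shape n
  have hW2 : width (n + 1 + 1) = 2 * width n := width_add_two n
  have hβ' := mem_octagon_iff.mp hβ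
  dsimp only at hβ'
  have ha1 : a ≤ width (n + 1) - 2 := by omega
  have hab2 : a + b ≤ width (n + 1 + 1) - 3 := by omega
  by_cases hp0 : x = 0 ∧ y = 0
  · refine ⟨0, ?_⟩
    rw [hp0.1, hp0.2, zero_mul, sub_zero, show (⟨0, 0⟩ : ℤ√(-1)) = 0 from rfl]
    exact zero_mem_digitSet n
  by_cases hev : x % 2 = 0 ∧ y % 2 = 0
  · exact leaf_even hK hW hW2 hab hb hodd ha1 hab2 hx hy hxy hev hp0
  have hpar : x % 2 = 1 ∨ y % 2 = 1 := by
    rcases Int.emod_two_eq_zero_or_one x with h1 | h1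
    · rcases Int.emod_two_eq_zero_or_one y with h2 | h2
      · exact absurd ⟨h1, h2⟩ hev
      · exact Or.inr h2
    · exact Or.inl h1
  by_cases hyW : width n - 1 ≤ y
  · exact leaf_top hK hW hW2 hab hb hodd ha1 hab2 hx hy hxy hpar hyW
  by_cases hxW : width n - 1 ≤ x
  · exact leaf_right hK hW hW2 hb hodd ha1 hab2 hx hy hxy hpar hxW
  exact leaf_box ha1 hx hy hxy hpar (by omega) (by omega)

/-! ## §4 `B_n ↠ ℤ[i]/β` for every `β ∈ Oct_{n+1}` prime to `1+i` -/

/-- Normal form `β = a+bi`, `a > b ≥ 0`, `a ≢ b (mod 2)`, `β ∈ Oct_{n+1}`: every Gaussian integer is congruent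
modulo `β` to an element of `B_n` (the covering of `𝒮` and Lemma 4.4). [cite: Graves2023, Thm. 5.3 (proof, pp. 8–9)] -/
theorem forall_exists_dvd_sub_of_normal {n : ℕ} {a b : ℤ} (hab : b < a) (hb : 0 ≤ b) (hodd : (a + b) % 2 = 1)
    (hβ : (⟨a, b⟩ : ℤ√(-1)) ∈ octagon (n + 1)) (z : ℤ√(-1)) :
    ∃ r ∈ digitSet n, (⟨a, b⟩ : ℤ√(-1)) ∣ z - r := by
  refine forall_exists_dvd_sub_of_triangle hab hb (fun h ↦ by omega) (B := digitSet n)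
    (fun r hr ↦ i_mul_mem_digitSet hr) (fun x y hx hy hxy ↦ ?_) z
  obtain ⟨q, hq⟩ := exists_sub_mul_mem_digitSet hab hb hodd hβ hx hy hxy
  exact ⟨_, hq, q, by ring⟩

/-- Transport along a unit: `B_n ↠ ℤ[i]/(uβ)` gives `B_n ↠ ℤ[i]/β`. [cite: Graves2023, §3 (p. 6)] -/
theorem forall_exists_dvd_sub_of_unit_mul {n : ℕ} {β u : ℤ√(-1)} (hu : IsUnit u)
    (h : ∀ z : ℤ√(-1), ∃ r ∈ digitSet n, u * β ∣ z - r) (z : ℤ√(-1)) : ∃ r ∈ digitSet n, β ∣ z - r := by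
  obtain ⟨r, hr, hd⟩ := h z
  exact ⟨r, hr, hu.mul_left_dvd.mp hd⟩

/-- Transport along conjugation (Lemma 3.1's mechanism): `B_n ↠ ℤ[i]/β̄` gives `B_n ↠ ℤ[i]/β`, since `B_n`
is closed under conjugation. [cite: Graves2023, Lemma 3.1 (p. 6)] -/
theorem forall_exists_dvd_sub_of_star {n : ℕ} {β : ℤ√(-1)}
    (h : ∀ z : ℤ√(-1), ∃ r ∈ digitSet n, star β ∣ z - r) (z : ℤ√(-1)) : ∃ r ∈ digitSet n, β ∣ z - r := by
  obtain ⟨r, hr, q, hq⟩ := h (star z)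
  refine ⟨star r, star_mem_digitSet hr, star q, ?_⟩
  have h' := congrArg star hq
  simp only [star_sub, star_star, star_mul] at h'
  rw [h', mul_comm]

/-- The units `i` and `−1` of `ℤ[i]`. [cite: Graves2023, §2 (p. 2)] -/
theorem isUnit_i : IsUnit (⟨0, 1⟩ : ℤ√(-1)) := IsUnit.of_mul_eq_one ⟨0, -1⟩ (by decide)

/-- **`B_n ↠ ℤ[i]/β` for every `β ∈ Oct_{n+1}` not divisible by `1+i`** (by units and conjugation —
Lemma 3.1, Corollary 3.2 — `β` is brought to the normal form `a > b ≥ 0`).  For `β ∉ B_n` this is the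
statement «if `a+bi ∈ B_{n+1} ∖ B_n`, `(1+i) ∤ a+bi`, then `B_n ↠ ℤ[i]/(a+bi)`» of §5.
[cite: Graves2023, Thm. 5.3 (proof, p. 8)] -/
theorem forall_exists_dvd_sub_of_mem_octagon {n : ℕ} {β : ℤ√(-1)} (hβ : β ∈ octagon (n + 1))
    (hprim : (β.re + β.im) % 2 = 1) (z : ℤ√(-1)) : ∃ r ∈ digitSet n, β ∣ z - r := by
  have hoct : ∀ a' b' : ℤ, (a'.natAbs : ℤ) = β.re.natAbs ∨ (a'.natAbs : ℤ) = β.im.natAbs →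
      (b'.natAbs : ℤ) = β.re.natAbs ∨ (b'.natAbs : ℤ) = β.im.natAbs →
      (a'.natAbs : ℤ) + b'.natAbs = β.re.natAbs + β.im.natAbs → (⟨a', b'⟩ : ℤ√(-1)) ∈ octagon (n + 1) := by
    intro a' b' h1 h2 h3
    have h := mem_octagon_iff.mp hβ
    rw [mem_octagon_iff]
    dsimp only
    omega
  have hneg1 : IsUnit (-1 : ℤ√(-1)) := isUnit_one.neg
  obtain ⟨a, b⟩ := β
  dsimp only at hprim hoct ⊢
  rcases le_or_gt 0 a with ha | ha <;> rcases le_or_gt 0 b with hb | hb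
  · rcases le_or_gt b a with h | h
    · -- already normal
      exact forall_exists_dvd_sub_of_normal (by omega) hb hprim (hoct a b (by omega) (by omega) rfl) z
    · -- `b + ai = i·β̄`
      refine forall_exists_dvd_sub_of_star (forall_exists_dvd_sub_of_unit_mul isUnit_i ?_) z
      rw [show (⟨0, 1⟩ : ℤ√(-1)) * star ⟨a, b⟩ = ⟨b, a⟩ from Zsqrtd.ext (by simp) (by simp)]
      exact forall_exists_dvd_sub_of_normal h ha (by omega) (hoct b a (by omega) (by omega) (by omega))
  · rcases le_or_gt (-b) a with h | h
    · -- `a − bi = β̄`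
      refine forall_exists_dvd_sub_of_star ?_ z
      rw [show (star ⟨a, b⟩ : ℤ√(-1)) = ⟨a, -b⟩ from Zsqrtd.ext (by simp) (by simp)]
      exact forall_exists_dvd_sub_of_normal (by omega) (by omega) (by omega)
        (hoct a (-b) (by omega) (by omega) (by omega))
    · -- `−b + ai = iβ`
      refine forall_exists_dvd_sub_of_unit_mul isUnit_i ?_ z
      rw [show (⟨0, 1⟩ : ℤ√(-1)) * ⟨a, b⟩ = ⟨-b, a⟩ from Zsqrtd.ext (by simp) (by simp)]
      exact forall_exists_dvd_sub_of_normal h ha (by omega) (hoct (-b) a (by omega) (by omega) (by omega))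
  · rcases le_or_gt b (-a) with h | h
    · -- `−a + bi = −β̄`
      refine forall_exists_dvd_sub_of_star (forall_exists_dvd_sub_of_unit_mul hneg1 ?_) z
      rw [show (-1 : ℤ√(-1)) * star ⟨a, b⟩ = ⟨-a, b⟩ from Zsqrtd.ext (by simp) (by simp)]
      exact forall_exists_dvd_sub_of_normal (by omega) hb (by omega)
        (hoct (-a) b (by omega) (by omega) (by omega))
    · -- `b − ai = −iβ`
      refine forall_exists_dvd_sub_of_unit_mul isUnit_i.neg ?_ z
      rw [show (-⟨0, 1⟩ : ℤ√(-1)) * ⟨a, b⟩ = ⟨b, -a⟩ from Zsqrtd.ext (by simp) (by simp)]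
      exact forall_exists_dvd_sub_of_normal h (by omega) (by omega)
        (hoct b (-a) (by omega) (by omega) (by omega))
  · rcases le_or_gt (-b) (-a) with h | h
    · -- `−a − bi = −β`
      refine forall_exists_dvd_sub_of_unit_mul hneg1 ?_ z
      rw [show (-1 : ℤ√(-1)) * ⟨a, b⟩ = ⟨-a, -b⟩ from Zsqrtd.ext (by simp) (by simp)]
      exact forall_exists_dvd_sub_of_normal (by omega) (by omega) (by omega)
        (hoct (-a) (-b) (by omega) (by omega) (by omega))
    · -- `−b − ai = conj(iβ)`
      refine forall_exists_dvd_sub_of_unit_mul isUnit_i (forall_exists_dvd_sub_of_star ?_) z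
      rw [show (star (⟨0, 1⟩ * ⟨a, b⟩) : ℤ√(-1)) = ⟨-b, -a⟩ from Zsqrtd.ext (by simp) (by simp)]
      exact forall_exists_dvd_sub_of_normal h (by omega) (by omega)
        (hoct (-b) (-a) (by omega) (by omega) (by omega))

/-! ## §5 Theorem 5.3 and the minimal Euclidean function -/

/-- The base case `A_{ℤ[i],0} = 0 ∪ ℤ[i]^× = {0, ±1, ±i} = B₀`. [cite: Graves2023, Thm. 5.3 (p. 8)] -/
theorem not_mem_motzkinSet_one_iff (z : ℤ√(-1)) : z ∉ (motzkinSet 1 : Set (ℤ√(-1))) ↔ z ∈ digitSet 0 := by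
  rw [motzkinSet_one, digitSet_zero]
  simp only [Set.mem_setOf_eq, not_and, not_not]
  constructor
  · intro h
    by_cases hz : z = 0
    · rw [hz]; exact zero_mem_digits
    · exact mem_digits_of_norm_eq_one ((norm_eq_one_iff' (by norm_num) z).mpr (h hz))
  · intro h _
    rcases mem_digits_iff.mp h with rfl | rfl | rfl | rfl | rfl
    · contradiction
    · exact isUnit_one
    · exact isUnit_one.neg
    · exact isUnit_i
    · exact isUnit_i.neg

/-- **Theorem 5.3**: «For `n ≥ 0`, `A_{ℤ[i],n} = B_n`», i.e. `z ∉ P₀^{(n+1)} ↔ z ∈ B_n` for every Gaussian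
integer `z`. [cite: Graves2023, Thm. 5.3 (p. 8)] -/
theorem not_mem_motzkinSet_succ_iff (n : ℕ) (z : ℤ√(-1)) :
    z ∉ (motzkinSet (n + 1) : Set (ℤ√(-1))) ↔ z ∈ digitSet n := by
  induction n using Nat.strong_induction_on generalizing z with
  | h n ih =>
    cases n with
    | zero => exact not_mem_motzkinSet_one_iff z
    | succ n =>
      refine ⟨mem_digitSet_succ_of_not_mem_motzkinSet (ih n (lt_add_one n)), fun hz ↦ ?_⟩
      rcases Int.emod_two_eq_zero_or_one (z.re + z.im) with hev | hprim
      · -- `z = (1+i) z'` with `z' ∈ B_n`: Lemma 3.4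
        obtain ⟨z', rfl⟩ := oneAddI_dvd_iff.mpr (Int.dvd_of_emod_eq_zero hev)
        exact oneAddI_mul_not_mem_motzkinSet (fun m hm w ↦ ih m (by omega) w)
          (mem_digitSet_of_oneAddI_mul_mem hz)
      · -- `z` prime to `1+i`: every class modulo `z` meets `B_n = (P₀^{(n+1)})ᶜ`
        refine not_mem_motzkinSet_succ_of_forall fun a ↦ ?_
        obtain ⟨r, hr, c, hc⟩ := forall_exists_dvd_sub_of_mem_octagon (mem_octagon_of_mem_digitSet hz) hprim a
        refine ⟨-c, ?_⟩
        rw [show a + z * -c = r by rw [mul_neg, ← hc]; ring]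
        exact (ih n (lt_add_one n) r).mpr hr

/-- **Theorem 5.3**, set form: `P₀^{(n+1)} = (B_n)ᶜ`, i.e. `A_{ℤ[i],n} = B_n`. [cite: Graves2023, Thm. 5.3 (p. 8)] -/
theorem motzkinSet_succ_eq_compl_digitSet (n : ℕ) : (motzkinSet (n + 1) : Set (ℤ√(-1))) = (digitSet n)ᶜ := by
  ext z
  rw [Set.mem_compl_iff]
  have h := not_mem_motzkinSet_succ_iff n z
  tauto

/-- `w_m ≥ m + 3` (the octagons exhaust the plane). [cite: Graves2023, Def. 2.3 (p. 3)] -/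
theorem le_width (m : ℕ) : (m : ℤ) + 3 ≤ width m := by
  induction m with
  | zero => simp
  | succ m ih => have := width_lt_width_succ m; push_cast; omega

/-- `ℤ[i] = ⋃_n B_n` (Graves: «`ℤ[i] = ⋃ A_{ℤ[i],n}`», §3); proved here directly from Theorem 2.5.
[cite: Graves2023, §3 (p. 6)] -/
theorem exists_mem_digitSet (z : ℤ√(-1)) : ∃ n : ℕ, z ∈ digitSet n := by
  by_cases hz : z = 0
  · exact ⟨0, hz ▸ zero_mem_digitSet 0⟩
  have hz' : ¬(z.re = 0 ∧ z.im = 0) := fun h' ↦ hz (Zsqrtd.ext h'.1 h'.2)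
  obtain ⟨k, ⟨hk1, hk2⟩, hk3⟩ := exists_exact_two_pow hz'
  obtain ⟨z₀, hzz, hre, him⟩ := eq_two_pow_mul hk1 hk2
  have hodd : ¬(2 ∣ z₀.re ∧ 2 ∣ z₀.im) := by
    rintro ⟨⟨c, hc⟩, ⟨d, hd⟩⟩
    refine hk3 ⟨⟨c, ?_⟩, ⟨d, ?_⟩⟩
    · rw [hre, hc, pow_succ]; ring
    · rw [him, hd, pow_succ]; ring
  set m : ℕ := z₀.re.natAbs + z₀.im.natAbs with hm
  have h1 := le_width m
  have h2 := le_width (m + 1)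
  have hz₀ : z₀ ∈ digitSet m :=
    mem_digitSet_of_not_two_dvd hodd (mem_octagon_iff.mpr ⟨by omega, by omega, by omega⟩)
  exact ⟨m + 2 * k, hzz ▸ two_pow_mul_mem_digitSet_iff.mpr hz₀⟩

/-- **Motzkin's criterion holds for `ℤ[i]`**: every Gaussian integer leaves the sequence `P₀ ⊇ P₀′ ⊇ ⋯`
(`ℤ[i] = A_{ℤ[i]}`; Graves obtains this from norm-Euclideanity and Lemma 1.3). [cite: Graves2023, §3 (p. 6)] -/
theorem forall_exists_not_mem_motzkinSet : ∀ z : ℤ√(-1), ∃ k : ℕ, z ∉ (motzkinSet k : Set (ℤ√(-1))) :=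
  fun z ↦
    let ⟨n, hn⟩ := exists_mem_digitSet z
    ⟨n + 1, (not_mem_motzkinSet_succ_iff n z).mpr hn⟩

/-- **The minimal Euclidean function of `ℤ[i]`** (`φ_{ℤ[i]}` = Motzkin's fastest norm `motzkinNorm`): for
`z ≠ 0`, `φ_{ℤ[i]}(z) ≤ n ↔ z ∈ B_n` — so `φ_{ℤ[i]}(z)` is the least `n` with `z ∈ B_n`, one less than the
number of digits of a shortest `(1+i)`-ary expansion of `z` with digits `0, ±1, ±i`.
[cite: Graves2023, Thm. 5.3 (p. 8)] -/
theorem motzkinNorm_le_iff_mem_digitSet {z : ℤ√(-1)} (hz : z ≠ 0) (n : ℕ) :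
    motzkinNorm forall_exists_not_mem_motzkinSet z ≤ n ↔ z ∈ digitSet n := by
  have hr : motzkinRank forall_exists_not_mem_motzkinSet z ≠ 0 :=
    fun h ↦ hz ((motzkinRank_eq_zero_iff _).mp h)
  rw [← not_mem_motzkinSet_succ_iff, ← motzkinRank_le_iff forall_exists_not_mem_motzkinSet]
  unfold motzkinNorm
  omega

/-- `z ∈ B_{φ(z)}` for `z ≠ 0`. [cite: Graves2023, Thm. 5.3 (p. 8)] -/
theorem mem_digitSet_motzkinNorm {z : ℤ√(-1)} (hz : z ≠ 0) :
    z ∈ digitSet (motzkinNorm forall_exists_not_mem_motzkinSet z) :=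
  (motzkinNorm_le_iff_mem_digitSet hz _).mp le_rfl

/-- `z ∉ B_m` for `m < φ(z)`. [cite: Graves2023, Thm. 5.3 (p. 8)] -/
theorem not_mem_digitSet_of_lt_motzkinNorm {z : ℤ√(-1)} (hz : z ≠ 0) {m : ℕ}
    (hm : m < motzkinNorm forall_exists_not_mem_motzkinSet z) : z ∉ digitSet m :=
  fun h ↦ absurd ((motzkinNorm_le_iff_mem_digitSet hz m).mpr h) (by omega)

/-- Lemma 1.3 made explicit for `ℤ[i]`: every residue class modulo a non-zero `β ∈ B_{n+1}` has a
representative in `B_n` (division with remainder for the minimal Euclidean function).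
[cite: Graves2023, Lemma 1.3 (p. 2)] -/
theorem exists_add_mul_mem_digitSet {n : ℕ} {β : ℤ√(-1)} (hβ : β ∈ digitSet (n + 1)) (hβ0 : β ≠ 0)
    (a : ℤ√(-1)) : ∃ q : ℤ√(-1), a + β * q ∈ digitSet n := by
  obtain ⟨q, hq⟩ := exists_add_mul_not_mem_motzkinSet hβ0 ((not_mem_motzkinSet_succ_iff (n + 1) β).mpr hβ) a
  exact ⟨q, (not_mem_motzkinSet_succ_iff n _).mp hq⟩

/-! ## §6 Cross-checks: `B₁`, the universal side divisors, and first values of `φ_{ℤ[i]}` -/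

/-- **`A_{ℤ[i],1} ∖ A_{ℤ[i],0}` is the set of universal side divisors** (Graves' Def. 1.2 with `j = 1`, Motzkin's
«`P₀″` is obtained from `P₀′` by exemption of the universal side divisors»): by Theorem 5.3, `u` is a universal
side divisor of `ℤ[i]` iff `u ∈ B₁ ∖ B₀` — consistent with the twelve side divisors `±1±i, ±2±i, ±1±2i` of
`ImaginaryQuadraticUniversalSideDivisors.lean`. [cite: Graves2023, Def. 1.2 (p. 1)] -/
theorem isUniversalSideDivisor_iff_mem_digitSet_one {u : ℤ√(-1)} :
    IsUniversalSideDivisor u ↔ u ∈ digitSet 1 ∧ u ∉ digitSet 0 := by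
  rw [← not_mem_motzkinSet_succ_iff 1 u, ← not_mem_motzkinSet_succ_iff 0 u, motzkinSet_two, motzkinSet_one]
  simp only [Set.mem_setOf_eq, not_and, not_not, Classical.not_imp]
  constructor
  · intro h
    exact ⟨fun _ _ ↦ h, h.ne_zero, h.not_isUnit⟩
  · rintro ⟨h, h0, hu⟩
    exact h h0 hu

/-- `B₁` explicitly: «`B₁ ∖ 0 = {±1, ±i, ±1 ± i, ±2 ± i, ±1 ± 2i}`», i.e. `z ∈ B₁` iff `z = 0` or `2 ∤ (x,y)`,
`|x|, |y| ≤ 2 = w₁ − 2`, `|x| + |y| ≤ 3 = w₂ − 3`. [cite: Graves2023, Thm. 2.5 (proof, p. 3)] -/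
theorem mem_digitSet_one_iff {z : ℤ√(-1)} : z ∈ digitSet 1 ↔ z = 0 ∨
    (¬(2 ∣ z.re ∧ 2 ∣ z.im) ∧ (z.re.natAbs : ℤ) ≤ 2 ∧ (z.im.natAbs : ℤ) ≤ 2 ∧ (z.re.natAbs : ℤ) + z.im.natAbs ≤ 3) := by
  by_cases hz : z = 0
  · simp only [hz, zero_mem_digitSet, true_or]
  simp only [hz, false_or]
  by_cases hev : 2 ∣ z.re ∧ 2 ∣ z.im
  · obtain ⟨⟨a, ha⟩, ⟨b, hb⟩⟩ := hev
    have hzw : z = 2 * ⟨a, b⟩ := Zsqrtd.ext (by simpa using ha) (by simpa using hb)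
    have hw : (⟨a, b⟩ : ℤ√(-1)) ≠ 0 := by rintro h; rw [h, mul_zero] at hzw; exact hz hzw
    refine iff_of_false ?_ (fun h ↦ h.1 ⟨⟨a, ha⟩, ⟨b, hb⟩⟩)
    rw [hzw]
    exact two_mul_not_mem_digitSet_one hw
  · rw [mem_digitSet_iff_mem_octagon_of_not_two_dvd hev, mem_octagon_iff, width_one, width_add_two, width_zero]
    simp only [hev, not_false_eq_true, true_and]
    norm_num

/-- The same with the parity condition spelled by remainders. [cite: Graves2023, Thm. 2.5 (proof, p. 3)] -/
theorem mem_digitSet_one_iff' {z : ℤ√(-1)} : z ∈ digitSet 1 ↔ (z.re = 0 ∧ z.im = 0) ∨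
    ((z.re % 2 = 1 ∨ z.im % 2 = 1) ∧ (z.re.natAbs : ℤ) ≤ 2 ∧ (z.im.natAbs : ℤ) ≤ 2 ∧
      (z.re.natAbs : ℤ) + z.im.natAbs ≤ 3) := by
  rw [mem_digitSet_one_iff, Zsqrtd.ext_iff]
  simp only [re_zero, im_zero]
  constructor
  · rintro (h | ⟨hodd, h1, h2, h3⟩)
    · exact Or.inl h
    · exact Or.inr ⟨emod_two_eq_one_or_of_not_two_dvd hodd, h1, h2, h3⟩
  · rintro (h | ⟨hpar, h1, h2, h3⟩)
    · exact Or.inl h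
    · exact Or.inr ⟨fun ⟨h4, h5⟩ ↦ by omega, h1, h2, h3⟩

/-- `|B₁| = 17`: the seventeen Gaussian integers `0, ±1, ±i, ±1±i, ±2±i, ±1±2i`.
[cite: Graves2023, Thm. 2.5 (proof, p. 3)] -/
theorem digitSet_one_eq : digitSet 1 =
    (({0, 1, -1, ⟨0, 1⟩, ⟨0, -1⟩, ⟨1, 1⟩, ⟨1, -1⟩, ⟨-1, 1⟩, ⟨-1, -1⟩, ⟨2, 1⟩, ⟨2, -1⟩, ⟨-2, 1⟩, ⟨-2, -1⟩,
      ⟨1, 2⟩, ⟨1, -2⟩, ⟨-1, 2⟩, ⟨-1, -2⟩} : Finset (ℤ√(-1))) : Set (ℤ√(-1))) := by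
  ext z
  rw [mem_digitSet_one_iff']
  simp only [Finset.coe_insert, Finset.coe_singleton, Set.mem_insert_iff, Set.mem_singleton_iff]
  obtain ⟨x, y⟩ := z
  simp only [Zsqrtd.ext_iff, re_zero, im_zero, re_one, im_one, re_neg, im_neg, neg_zero]
  constructor
  · rintro (⟨rfl, rfl⟩ | ⟨hpar, h1, h2, h3⟩)
    · decide
    · have hx : -2 ≤ x ∧ x ≤ 2 := by omega
      have hy : -2 ≤ y ∧ y ≤ 2 := by omega
      obtain ⟨hx1, hx2⟩ := hx
      obtain ⟨hy1, hy2⟩ := hy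
      interval_cases x <;> interval_cases y <;> first | decide | (exfalso; omega)
  · rintro (⟨rfl, rfl⟩ | ⟨rfl, rfl⟩ | ⟨rfl, rfl⟩ | ⟨rfl, rfl⟩ | ⟨rfl, rfl⟩ | ⟨rfl, rfl⟩ | ⟨rfl, rfl⟩ |
      ⟨rfl, rfl⟩ | ⟨rfl, rfl⟩ | ⟨rfl, rfl⟩ | ⟨rfl, rfl⟩ | ⟨rfl, rfl⟩ | ⟨rfl, rfl⟩ | ⟨rfl, rfl⟩ | ⟨rfl, rfl⟩ |
      ⟨rfl, rfl⟩ | ⟨rfl, rfl⟩) <;> decide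

/-- Hence `B₁` has `17` elements. [cite: Graves2023, Thm. 2.5 (proof, p. 3)] -/
theorem ncard_digitSet_one : (digitSet 1).ncard = 17 := by
  rw [digitSet_one_eq, Set.ncard_coe_finset]
  decide

/-- `φ_{ℤ[i]}(1+i) = 1` (the base: `1+i ∈ B₁ ∖ B₀`). [cite: Graves2023, §1 (p. 2)] -/
theorem motzkinNorm_oneAddI : motzkinNorm forall_exists_not_mem_motzkinSet (⟨1, 1⟩ : ℤ√(-1)) = 1 := by
  have h0 : (⟨1, 1⟩ : ℤ√(-1)) ≠ 0 := by decide
  have h1 : (⟨1, 1⟩ : ℤ√(-1)) ∈ digitSet 1 :=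
    mem_digitSet_one_iff.mpr (Or.inr ⟨fun ⟨h, _⟩ ↦ by dsimp only at h; omega, by decide, by decide, by decide⟩)
  have h1' : (⟨1, 1⟩ : ℤ√(-1)) ∉ digitSet 0 := by
    rw [digitSet_zero, mem_digits_iff_natAbs]; decide
  have := (motzkinNorm_le_iff_mem_digitSet h0 1).mpr h1
  have := mt (motzkinNorm_le_iff_mem_digitSet h0 0).mp h1'
  omega

/-- `φ_{ℤ[i]}(2) = 2` (`2 = −i(1+i)²` has three digits and no fewer: `2 ∈ B₂ ∖ B₁`). [cite: Graves2023, §1 (p. 2)] -/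
theorem motzkinNorm_two : motzkinNorm forall_exists_not_mem_motzkinSet (2 : ℤ√(-1)) = 2 := by
  have h0 : (2 : ℤ√(-1)) ≠ 0 := by decide
  have h2 : (2 : ℤ√(-1)) ∈ digitSet 2 := by
    simpa using (two_mul_mem_digitSet_iff (n := 0) (y := 1)).mpr one_mem_digits
  have h1 : (2 : ℤ√(-1)) ∉ digitSet 1 := by
    simpa using two_mul_not_mem_digitSet_one (y := (1 : ℤ√(-1))) one_ne_zero
  have := (motzkinNorm_le_iff_mem_digitSet h0 2).mpr h2
  have := mt (motzkinNorm_le_iff_mem_digitSet h0 1).mp h1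
  omega

/-- `φ_{ℤ[i]}(3) = 2` although `N(3) = 9 > N(2+2i) = 8 = N` of an element with `φ = 3`: the minimal Euclidean
function is not monotone in the norm (`3 = 1 + 0·(1+i) − i(1+i)² ∈ B₂ ∖ B₁`). [cite: Graves2023, Thm. 5.3 (p. 8)] -/
theorem motzkinNorm_three : motzkinNorm forall_exists_not_mem_motzkinSet (3 : ℤ√(-1)) = 2 := by
  have h0 : (3 : ℤ√(-1)) ≠ 0 := by decide
  have hodd : ¬(2 ∣ (3 : ℤ√(-1)).re ∧ 2 ∣ (3 : ℤ√(-1)).im) := fun ⟨h, _⟩ ↦ by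
    rw [show (3 : ℤ√(-1)).re = 3 from rfl] at h; omega
  have h2 : (3 : ℤ√(-1)) ∈ digitSet 2 :=
    mem_digitSet_of_not_two_dvd hodd (mem_octagon_iff.mpr (by rw [width_add_two, width_add_two]; decide))
  have h1 : (3 : ℤ√(-1)) ∉ digitSet 1 := fun h ↦ by
    have := mem_octagon_iff.mp (mem_octagon_of_mem_digitSet h)
    rw [show (3 : ℤ√(-1)).re = 3 from rfl, width_one] at this
    omega
  have := (motzkinNorm_le_iff_mem_digitSet h0 2).mpr h2
  have := mt (motzkinNorm_le_iff_mem_digitSet h0 1).mp h1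
  omega

end Literature.NumberTheory.QuadraticFields.GaussianDigits
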